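import Summits.BirchSwinnertonDyer.BirchSwinnertonDyer.Theorems.ResidualThetaTransportAtTwoThetaLayerLambdaCongruenceAtTwoCuspSpanDescentEngine
import HarnessLib

/-!
# Route `ResidualThetaTransportAtTwo`, crux Kan⁺ `ThetaLayerLambdaCongruenceAtTwo` (stmt-BirchSwinnertonDyer-20688), node
# (G′)_N = `SignedMuAtTwo.CuspSpanEvenAtTwo N`: the descent-certificate engine, part 2 — (G″)_N and the NAMED node from the
# row property; the row-walking lemmas `tail_last` / `tail_cons` / `row_of_tail` used by the per-level table files

Cell `bsd-wall`, width seat `bsd-wall-rtt-p3-w2` g3 (2026-08-28). THEOREMS ONLY; `--supports stmt-BirchSwinnertonDyer-20688`; BSD is not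
proved by this. Part 1 (`…CuspSpanDescentEngine`) proves the descent: the ROW PROPERTY at level `N` (for every `q < N` and state
`(r, B)` a witness `(y, c, fl, k, y₁, ε)`) makes every admissible `χ` vanish on `d̄⁻¹(±⟨4⟩)`. Here: §3 `χ = ψ ∘ d` with `ψ`
multiplicative (`cuspSpanTrace_of_rows`) and the named node `cuspSpanEvenAtTwo_of_rows`; §4 the walking lemmas by which a row
«open cell, Farey point, open cell, …, last cell» given by explicit numerals discharges the row property (`decide` per cell).

References: A. W. Knapp, *Elliptic curves* (1992) Prop. 11.22 [Knapp1993]; Ju. I. Manin, Izv. 36 (1972) §1.5 [Manin1972];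
R. Pollack, Duke Math. J. 118 (2003) Conj. 6.3 [Pollack2003].
-/

set_option autoImplicit false
set_option linter.dupNamespace false

noncomputable section

open scoped MatrixGroups

open CongruenceSubgroup

namespace Summit.BirchSwinnertonDyer.BirchSwinnertonDyer.Theorems.SignedMuAtTwo

/-! ## §3. (G″)_N and the named node from the row property -/

section Named

variable {N : ℕ} [NeZero N]

/-- **(G″)_N from the row property**: under the hypotheses of `chi_eq_zero_of_rows`, every additive `χ : Γ₀(N) → ZMod 2` killing
the small-trace elements and the `4^k`-classes is `ψ ∘ d` with `ψ` multiplicative on units (indeed a character of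
`(ℤ/N)^× / ±⟨4⟩`): `χ γ` depends only on `d(γ) mod N` (if `d(γ) ≡ d(δ)` then `γ·δ^{adj}` has upper-left entry `≡ 1`), and
`ψ(u) := χ(γ_u)` for any `γ_u` with `d(γ_u) ≡ u`. [cite: Knapp1993, Prop. 11.22] [cite: Pollack2003, Conj. 6.3] -/
theorem cuspSpanTrace_of_rows (hN : Odd N)
    (hrows : ∀ q : ℕ, q < N → ∀ r B : ℕ, 0 < r → r < B → Nat.Coprime r B → Nat.Coprime (q * B + r) N →
      ∃ (y c fl k : ℕ) (y₁ ε : ℤ), c ≤ 1 ∧ 1 ≤ k ∧ (ε = 1 ∨ ε = -1) ∧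
        Int.gcd ((y * q + fl + c : ℕ) : ℤ) (N * y₁) = 1 ∧ (N : ℤ) * y₁ ∣ ((y * q + fl + c : ℕ) : ℤ) + ε * 4 ^ k ∧
        (((y * q + fl + c : ℕ)) : ℤ) ∣ y₁ - y ∧ fl * B ≤ y * r ∧ y * r < (fl + 1) * B ∧ (c = 1 → fl * B ≠ y * r)) :
    ∀ χ : Gamma0 N → ZMod 2,
      (∀ γ δ : Gamma0 N, χ (γ * δ) = χ γ + χ δ) →
      (∀ γ : Gamma0 N, ((γ : SL(2, ℤ)) 0 0 + (γ : SL(2, ℤ)) 1 1).natAbs ≤ 2 → χ γ = 0) →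
      (∀ γ : Gamma0 N, (∃ k : ℕ, 1 ≤ k ∧ ((γ : SL(2, ℤ)) 1 1).natAbs = 4 ^ k) → χ γ = 0) →
      ∃ ψ : ZMod N → ZMod 2, (∀ x y : ZMod N, IsUnit x → IsUnit y → ψ (x * y) = ψ x + ψ y) ∧
        ∀ γ : Gamma0 N, χ γ = ψ ((((γ : SL(2, ℤ)) 1 1 : ℤ) : ZMod N)) := by
  intro χ hadd hsmall hkill
  have main := chi_eq_zero_of_rows hN hrows χ hadd hsmall hkill
  -- `χ γ` depends only on `d(γ) mod N`
  have hB : ∀ γ δ : Gamma0 N, ((((γ : SL(2, ℤ)) 1 1 : ℤ) : ZMod N)) = (((δ : SL(2, ℤ)) 1 1 : ℤ) : ZMod N) →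
      χ γ = χ δ := by
    intro γ δ hγδ
    have hdetδ0 : (δ : SL(2, ℤ)) 0 0 * (δ : SL(2, ℤ)) 1 1 - (δ : SL(2, ℤ)) 0 1 * (δ : SL(2, ℤ)) 1 0 = 1 :=
      (by have h := Matrix.SpecialLinearGroup.det_coe (δ : SL(2, ℤ)); rwa [Matrix.det_fin_two] at h)
    have hdetγ0 : (γ : SL(2, ℤ)) 0 0 * (γ : SL(2, ℤ)) 1 1 - (γ : SL(2, ℤ)) 0 1 * (γ : SL(2, ℤ)) 1 0 = 1 :=
      (by have h := Matrix.SpecialLinearGroup.det_coe (γ : SL(2, ℤ)); rwa [Matrix.det_fin_two] at h)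
    have hdvdδ : (N : ℤ) ∣ (δ : SL(2, ℤ)) 1 0 :=
      (by have h := Gamma0_mem.mp δ.2; exact (ZMod.intCast_zmod_eq_zero_iff_dvd _ N).mp (by exact_mod_cast h))
    have hdvdγ : (N : ℤ) ∣ (γ : SL(2, ℤ)) 1 0 :=
      (by have h := Gamma0_mem.mp γ.2; exact (ZMod.intCast_zmod_eq_zero_iff_dvd _ N).mp (by exact_mod_cast h))
    obtain ⟨δ', p00, -, p10, -⟩ := ThetaLayerLambdaCongruenceAtTwo.exists_gamma0_entries (N := N)
      ((δ : SL(2, ℤ)) 1 1) (-((δ : SL(2, ℤ)) 0 1)) (-((δ : SL(2, ℤ)) 1 0)) ((δ : SL(2, ℤ)) 0 0)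
      (by linear_combination hdetδ0) hdvdδ.neg_right
    have hδ10 : ((((δ : SL(2, ℤ)) 1 0 : ℤ) : ZMod N)) = 0 :=
      (ZMod.intCast_zmod_eq_zero_iff_dvd _ N).mpr hdvdδ
    have hγ10 : ((((γ : SL(2, ℤ)) 1 0 : ℤ) : ZMod N)) = 0 :=
      (ZMod.intCast_zmod_eq_zero_iff_dvd _ N).mpr hdvdγ
    have hdetγ := congrArg (fun z : ℤ ↦ (z : ZMod N)) hdetγ0
    have hdetδ := congrArg (fun z : ℤ ↦ (z : ZMod N)) hdetδ0
    push_cast at hdetγ hdetδ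
    rw [hγ10, mul_zero, sub_zero] at hdetγ
    rw [hδ10, mul_zero, sub_zero] at hdetδ
    have h1 : χ (δ * δ') = 0 := by
      refine main _ ⟨0, Or.inl ?_⟩
      rw [gamma0_mul_apply_zero_zero', p00, p10, pow_zero]
      push_cast
      rw [hδ10, neg_zero, mul_zero, add_zero]
      exact hdetδ
    have h2 : χ (γ * δ') = 0 := by
      refine main _ ⟨0, Or.inl ?_⟩
      rw [gamma0_mul_apply_zero_zero', p00, p10, pow_zero]
      push_cast
      rw [hδ10, neg_zero, mul_zero, add_zero, ← hγδ]
      exact hdetγ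
    rw [hadd] at h1 h2
    linear_combination h2 - h1
  -- a `γ_u ∈ Γ₀(N)` with `d(γ_u) ≡ u` for every unit `u`
  have hpick : ∀ u : ZMod N, IsUnit u → ∃ γ : Gamma0 N, ((((γ : SL(2, ℤ)) 1 1 : ℤ) : ZMod N)) = u := by
    intro u hu
    have hcop : Nat.Coprime u.val N := by
      rw [← ZMod.natCast_zmod_val u, ZMod.isUnit_iff_coprime] at hu
      exact hu
    obtain ⟨x, z, hxz⟩ := Nat.isCoprime_iff_coprime.mpr hcop
    obtain ⟨γ, -, -, -, h11⟩ := ThetaLayerLambdaCongruenceAtTwo.exists_gamma0_entries (N := N)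
      x (-1) ((N : ℤ) * z) (u.val : ℤ) (by linear_combination hxz) (dvd_mul_right _ _)
    refine ⟨γ, ?_⟩
    rw [h11]
    push_cast
    exact ZMod.natCast_zmod_val u
  classical
  refine ⟨fun u ↦ if hu : IsUnit u then χ (Classical.choose (hpick u hu)) else 0, ?_, ?_⟩
  · intro x y hx hy
    have hxy : IsUnit (x * y) := hx.mul hy
    simp only [dif_pos hx, dif_pos hy, dif_pos hxy]
    have ex := Classical.choose_spec (hpick x hx)
    have ey := Classical.choose_spec (hpick y hy)
    have exy := Classical.choose_spec (hpick (x * y) hxy)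
    set gx := Classical.choose (hpick x hx)
    set gy := Classical.choose (hpick y hy)
    set gxy := Classical.choose (hpick (x * y) hxy)
    have hgx10 : ((((gx : SL(2, ℤ)) 1 0 : ℤ) : ZMod N)) = 0 := by
      have h := Gamma0_mem.mp gx.2; exact_mod_cast h
    have hprod : ((((gx * gy : Gamma0 N) : SL(2, ℤ)) 1 1 : ℤ) : ZMod N) = x * y := by
      rw [gamma0_mul_apply_one_one']
      push_cast
      rw [hgx10, zero_mul, zero_add, ex, ey]
    rw [← hadd, hB gxy (gx * gy) (by rw [exy, hprod])]
  · intro γ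
    have hu := isUnit_gamma0_apply_one_one γ
    simp only [dif_pos hu]
    exact hB γ _ (Classical.choose_spec (hpick _ hu)).symm

/-- **`CuspSpanEvenAtTwo N` from the row property** — the named node (G′)_N of `…CuspSpanDefs` at an ARBITRARY odd level `N`
from a validated descent table (via rtt-p4-w3's `cuspSpanEvenAtTwo_of_cuspSpanTrace`). Per-level files discharge the row property
from explicit numerals with `tail_cons` / `tail_last` below. [cite: Pollack2003, Conj. 6.3] [cite: Manin1972, §1.5] -/
theorem cuspSpanEvenAtTwo_of_rows (hN : Odd N)
    (hrows : ∀ q : ℕ, q < N → ∀ r B : ℕ, 0 < r → r < B → Nat.Coprime r B → Nat.Coprime (q * B + r) N →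
      ∃ (y c fl k : ℕ) (y₁ ε : ℤ), c ≤ 1 ∧ 1 ≤ k ∧ (ε = 1 ∨ ε = -1) ∧
        Int.gcd ((y * q + fl + c : ℕ) : ℤ) (N * y₁) = 1 ∧ (N : ℤ) * y₁ ∣ ((y * q + fl + c : ℕ) : ℤ) + ε * 4 ^ k ∧
        (((y * q + fl + c : ℕ)) : ℤ) ∣ y₁ - y ∧ fl * B ≤ y * r ∧ y * r < (fl + 1) * B ∧ (c = 1 → fl * B ≠ y * r)) :
    CuspSpanEvenAtTwo N :=
  cuspSpanEvenAtTwo_of_cuspSpanTrace (cuspSpanTrace_of_rows hN hrows)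

end Named

/-! ## §4. Walking a row of the table: `tail_last`, `tail_cons`, `row_of_tail` -/

section Walk

variable {N : ℕ}

/-- Equal reduced fractions have equal numerators and denominators. [folklore] -/
theorem eq_of_mul_eq_mul_of_coprime {r B num den : ℕ} (h : r * den = num * B) (hrB : Nat.Coprime r B)
    (hnd : Nat.Coprime num den) (hB : 0 < B) (hden : 0 < den) : r = num ∧ B = den := by
  have h1 : B ∣ den := by
    have : B ∣ r * den := ⟨num, by rw [h, mul_comm]⟩
    exact hrB.symm.dvd_of_dvd_mul_left this
  have h2 : den ∣ B := by
    have : den ∣ num * B := ⟨r, by rw [← h, mul_comm]⟩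
    exact hnd.symm.dvd_of_dvd_mul_left this
  have hBd : B = den := Nat.dvd_antisymm h1 h2
  subst hBd
  exact ⟨Nat.eq_of_mul_eq_mul_right hB h, rfl⟩

/-- **Last cell of a row** `(lo, 1)`: a witness with `fl ≤ y·lo` and `y ≤ fl + 1` (so `⌊yθ⌋ = fl` on the whole cell) serves every
state `θ = r/B ∈ (lo, 1)`. [folklore] -/
theorem tail_last (q lo₁ lo₂ : ℕ) (y c fl k : ℕ) (y₁ ε : ℤ)
    (hw : c ≤ 1 ∧ 1 ≤ k ∧ (ε = 1 ∨ ε = -1) ∧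
      Int.gcd ((y * q + fl + c : ℕ) : ℤ) (N * y₁) = 1 ∧ (N : ℤ) * y₁ ∣ ((y * q + fl + c : ℕ) : ℤ) + ε * 4 ^ k ∧
      (((y * q + fl + c : ℕ)) : ℤ) ∣ y₁ - y)
    (hfl : 1 ≤ y ∧ fl * lo₂ ≤ y * lo₁ ∧ y ≤ fl + 1) :
    ∀ r B : ℕ, lo₁ * B < r * lo₂ → r < B → Nat.Coprime r B → Nat.Coprime (q * B + r) N →
      ∃ (y c fl k : ℕ) (y₁ ε : ℤ), c ≤ 1 ∧ 1 ≤ k ∧ (ε = 1 ∨ ε = -1) ∧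
        Int.gcd ((y * q + fl + c : ℕ) : ℤ) (N * y₁) = 1 ∧ (N : ℤ) * y₁ ∣ ((y * q + fl + c : ℕ) : ℤ) + ε * 4 ^ k ∧
        (((y * q + fl + c : ℕ)) : ℤ) ∣ y₁ - y ∧ fl * B ≤ y * r ∧ y * r < (fl + 1) * B ∧ (c = 1 → fl * B ≠ y * r) := by
  intro r B hlo hrB _ _
  obtain ⟨hy, hfl1, hfl2⟩ := hfl
  have hlow : fl * B < y * r := by
    have h1 : fl * lo₂ * B ≤ y * lo₁ * B := Nat.mul_le_mul_right _ hfl1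
    have h2 : y * (lo₁ * B) < y * (r * lo₂) := Nat.mul_lt_mul_of_pos_left hlo hy
    have h3 : fl * B * lo₂ < y * r * lo₂ := by nlinarith
    exact Nat.lt_of_mul_lt_mul_right h3
  refine ⟨y, c, fl, k, y₁, ε, hw.1, hw.2.1, hw.2.2.1, hw.2.2.2.1, hw.2.2.2.2.1, hw.2.2.2.2.2, hlow.le, ?_,
    fun _ ↦ Nat.ne_of_lt hlow⟩
  calc y * r ≤ (fl + 1) * r := Nat.mul_le_mul_right _ hfl2
    _ < (fl + 1) * B := Nat.mul_lt_mul_of_pos_left hrB (Nat.succ_pos _)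

/-- **A cell followed by a point**: the open cell `(lo, num/den)` with its witness (`fl ≤ y·lo`, `y·num ≤ (fl+1)·den`), the Farey
point `num/den` — either not a state (`gcd(q·den + num, N) > 1`) or with a point witness (`fl·den ≤ y·num < (fl+1)·den`,
`c = 1 → fl·den ≠ y·num`) — and the tail property from `num/den` on give the tail property from `lo` on. [folklore] -/
theorem tail_cons (q lo₁ lo₂ num den : ℕ)
    (hpt : lo₁ * den < num * lo₂ ∧ num < den ∧ Nat.Coprime num den)
    (y c fl k : ℕ) (y₁ ε : ℤ)
    (hI : (c ≤ 1 ∧ 1 ≤ k ∧ (ε = 1 ∨ ε = -1) ∧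
      Int.gcd ((y * q + fl + c : ℕ) : ℤ) (N * y₁) = 1 ∧ (N : ℤ) * y₁ ∣ ((y * q + fl + c : ℕ) : ℤ) + ε * 4 ^ k ∧
      (((y * q + fl + c : ℕ)) : ℤ) ∣ y₁ - y) ∧ 1 ≤ y ∧ fl * lo₂ ≤ y * lo₁ ∧ y * num ≤ (fl + 1) * den)
    (hP : ¬ Nat.Coprime (q * den + num) N ∨
      ∃ (y c fl k : ℕ) (y₁ ε : ℤ), (c ≤ 1 ∧ 1 ≤ k ∧ (ε = 1 ∨ ε = -1) ∧
        Int.gcd ((y * q + fl + c : ℕ) : ℤ) (N * y₁) = 1 ∧ (N : ℤ) * y₁ ∣ ((y * q + fl + c : ℕ) : ℤ) + ε * 4 ^ k ∧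
        (((y * q + fl + c : ℕ)) : ℤ) ∣ y₁ - y) ∧ fl * den ≤ y * num ∧ y * num < (fl + 1) * den ∧ (c = 1 → fl * den ≠ y * num))
    (htail : ∀ r B : ℕ, num * B < r * den → r < B → Nat.Coprime r B → Nat.Coprime (q * B + r) N →
      ∃ (y c fl k : ℕ) (y₁ ε : ℤ), c ≤ 1 ∧ 1 ≤ k ∧ (ε = 1 ∨ ε = -1) ∧
        Int.gcd ((y * q + fl + c : ℕ) : ℤ) (N * y₁) = 1 ∧ (N : ℤ) * y₁ ∣ ((y * q + fl + c : ℕ) : ℤ) + ε * 4 ^ k ∧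
        (((y * q + fl + c : ℕ)) : ℤ) ∣ y₁ - y ∧ fl * B ≤ y * r ∧ y * r < (fl + 1) * B ∧ (c = 1 → fl * B ≠ y * r)) :
    ∀ r B : ℕ, lo₁ * B < r * lo₂ → r < B → Nat.Coprime r B → Nat.Coprime (q * B + r) N →
      ∃ (y c fl k : ℕ) (y₁ ε : ℤ), c ≤ 1 ∧ 1 ≤ k ∧ (ε = 1 ∨ ε = -1) ∧
        Int.gcd ((y * q + fl + c : ℕ) : ℤ) (N * y₁) = 1 ∧ (N : ℤ) * y₁ ∣ ((y * q + fl + c : ℕ) : ℤ) + ε * 4 ^ k ∧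
        (((y * q + fl + c : ℕ)) : ℤ) ∣ y₁ - y ∧ fl * B ≤ y * r ∧ y * r < (fl + 1) * B ∧ (c = 1 → fl * B ≠ y * r) := by
  intro r B hlo hrB hcop hunit
  obtain ⟨hpt1, hpt2, hpt3⟩ := hpt
  have hden : 0 < den := by omega
  have hB : 0 < B := by omega
  rcases lt_trichotomy (r * den) (num * B) with hlt | heq | hgt
  · -- inside the open cell `(lo, num/den)`
    obtain ⟨hw, hy, hfl1, hfl2⟩ := hI
    have hlow : fl * B < y * r := by
      have h1 : fl * lo₂ * B ≤ y * lo₁ * B := Nat.mul_le_mul_right _ hfl1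
      have h2 : y * (lo₁ * B) < y * (r * lo₂) := Nat.mul_lt_mul_of_pos_left hlo hy
      have h3 : fl * B * lo₂ < y * r * lo₂ := by nlinarith
      exact Nat.lt_of_mul_lt_mul_right h3
    have hup : y * r < (fl + 1) * B := by
      have h2 : y * (r * den) < y * (num * B) := Nat.mul_lt_mul_of_pos_left hlt hy
      have h3 : y * num * B ≤ (fl + 1) * den * B := Nat.mul_le_mul_right _ hfl2
      have h4 : y * r * den < (fl + 1) * B * den := by nlinarith
      exact Nat.lt_of_mul_lt_mul_right h4
    exact ⟨y, c, fl, k, y₁, ε, hw.1, hw.2.1, hw.2.2.1, hw.2.2.2.1, hw.2.2.2.2.1, hw.2.2.2.2.2, hlow.le, hup,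
      fun _ ↦ Nat.ne_of_lt hlow⟩
  · -- at the Farey point: `r = num`, `B = den`
    obtain ⟨hr, hBd⟩ := eq_of_mul_eq_mul_of_coprime heq hcop hpt3 hB hden
    subst hr; subst hBd
    rcases hP with hbad | ⟨y', c', fl', k', y₁', ε', hw, hfl1, hfl2, hfl3⟩
    · exact absurd hunit hbad
    · exact ⟨y', c', fl', k', y₁', ε', hw.1, hw.2.1, hw.2.2.1, hw.2.2.2.1, hw.2.2.2.2.1, hw.2.2.2.2.2, hfl1, hfl2, hfl3⟩
  · -- beyond the point
    exact htail r B hgt hrB hcop hunit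

/-- **Start of a row**: the tail property from `0/1` on is the row property at `q`. [folklore] -/
theorem row_of_tail (q : ℕ)
    (htail : ∀ r B : ℕ, 0 * B < r * 1 → r < B → Nat.Coprime r B → Nat.Coprime (q * B + r) N →
      ∃ (y c fl k : ℕ) (y₁ ε : ℤ), c ≤ 1 ∧ 1 ≤ k ∧ (ε = 1 ∨ ε = -1) ∧
        Int.gcd ((y * q + fl + c : ℕ) : ℤ) (N * y₁) = 1 ∧ (N : ℤ) * y₁ ∣ ((y * q + fl + c : ℕ) : ℤ) + ε * 4 ^ k ∧
        (((y * q + fl + c : ℕ)) : ℤ) ∣ y₁ - y ∧ fl * B ≤ y * r ∧ y * r < (fl + 1) * B ∧ (c = 1 → fl * B ≠ y * r)) :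
    ∀ r B : ℕ, 0 < r → r < B → Nat.Coprime r B → Nat.Coprime (q * B + r) N →
      ∃ (y c fl k : ℕ) (y₁ ε : ℤ), c ≤ 1 ∧ 1 ≤ k ∧ (ε = 1 ∨ ε = -1) ∧
        Int.gcd ((y * q + fl + c : ℕ) : ℤ) (N * y₁) = 1 ∧ (N : ℤ) * y₁ ∣ ((y * q + fl + c : ℕ) : ℤ) + ε * 4 ^ k ∧
        (((y * q + fl + c : ℕ)) : ℤ) ∣ y₁ - y ∧ fl * B ≤ y * r ∧ y * r < (fl + 1) * B ∧ (c = 1 → fl * B ≠ y * r) :=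
  fun r B hr ↦ htail r B (by simpa using hr)

end Walk

end Summit.BirchSwinnertonDyer.BirchSwinnertonDyer.Theorems.SignedMuAtTwo

end
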